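import Literature.Topology.FourManifolds.MMSWPictureModelMap
import HarnessLib

/-!
# The model identification is injective on the model hypersurface

Topic `Literature/Topology/FourManifolds`; part of the proof of the named fact
`Literature.Topology.FourManifolds.pictureSurgeryPresentation` (`MMSWPictureSurgery.lean`; Kirby,
*The Topology of 4-Manifolds*, LNM 1374 (1989), Ch. I §2, Lemma 2.1).  Everything here is proved;
no named fact is introduced.

In the complex coordinates `(z, w)` the model boundary `M_k` is the guarded level hypersurface
`Mset k = {|z − c_j| ≥ 1 ∀ j, g_k(z) + |w|² = 1}`.  We prove:

* elementary bounds on `Mset` (`|z| ≤ 40(k+1)`, `g ≤ 1`, the zone dichotomy near the cores);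
* bounds on the virtual planar point of a point of `Mset` off the cores
  (`norm_zmod_sub_holeCentre_lt`, `le_norm_zmod_of_far`, `re_zmod_add_drawRadius_pos`);
* **the virtual data determine the point**: `(z, w) ↦ (Z_mod(z, w), w/|w|)` is injective on
  `Mset ∩ {w ≠ 0}` (`eq_of_zmod_eq`), by the injectivity of the compression straightening maps of
  the collars and the no-return lemma;
* **injectivity of the model map** (`injOn_modelMap`) on `Mset`, given the set-theoretic gluing
  data of a surgery presentation.

## References

* R. Kirby, *The Topology of 4-Manifolds*, LNM 1374 (1989), Ch. I §2. [Kirby1989]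
-/

open scoped Manifold ContDiff Topology Real ComplexConjugate
open Function Set Metric

noncomputable section

namespace Literature.Topology.FourManifolds

/-- Local notation: `𝔼 n` is the model Euclidean space `EuclideanSpace ℝ (Fin n)`. -/
local notation "𝔼 " n:arg => EuclideanSpace ℝ (Fin n)
/-- Local notation: `𝕊 n` is the unit sphere of `EuclideanSpace ℝ (Fin (n + 1))`. -/
local notation "𝕊 " n:arg => (Metric.sphere (0 : EuclideanSpace ℝ (Fin (n + 1))) 1)

namespace MMSW

variable {k : ℕ} {η : ℝ}

/-! ## The model hypersurface -/

/-- **The model hypersurface** `M_k` in complex coordinates: the guard `|z − c_j| ≥ 1` and the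
level condition `g_k(z) + |w|² = 1`. [folklore] -/
def Mset (k : ℕ) : Set (ℂ × ℂ) :=
  {p | (∀ j : Fin k, 1 ≤ ‖p.1 - holeCentre k j‖) ∧ planarPot k p.1 + ‖p.2‖ ^ 2 = 1}

variable {p q : ℂ × ℂ}

/-- On `M_k` the potential is `≤ 1`. [folklore] -/
theorem planarPot_le_one_of_mem (hp : p ∈ Mset k) : planarPot k p.1 ≤ 1 := by
  have := hp.2; nlinarith [norm_nonneg p.2]

/-- On `M_k` the potential is `1 − |w|²`. [folklore] -/
theorem planarPot_eq_of_mem (hp : p ∈ Mset k) : planarPot k p.1 = 1 - ‖p.2‖ ^ 2 := by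
  linarith [hp.2]

/-- Points of `M_k` are off the poles. [folklore] -/
theorem ne_holeCentre_of_mem (hp : p ∈ Mset k) (j : Fin k) : p.1 ≠ holeCentre k j := by
  intro h
  have := hp.1 j
  rw [h, sub_self, norm_zero] at this
  linarith

/-- On `M_k`, `|z| ≤ 40(k+1)`. [folklore] -/
theorem norm_fst_le_of_mem (hp : p ∈ Mset k) : ‖p.1‖ ≤ 40 * ((k : ℝ) + 1) := by
  have hg := planarPot_le_one_of_mem hp
  rw [planarPot_eq_bigRadius] at hg
  have hsum : 0 ≤ ∑ j : Fin k, 1 / Complex.normSq (p.1 - holeCentre k j) :=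
    Finset.sum_nonneg fun j _ ↦ one_div_nonneg.2 (Complex.normSq_nonneg _)
  have hR := bigRadius_pos (k := k)
  have h1 : Complex.normSq p.1 / bigRadius k ^ 2 ≤ 1 := by linarith
  rw [div_le_one (by positivity), Complex.normSq_eq_norm_sq] at h1
  rw [bigRadius] at h1
  have hk : (0 : ℝ) ≤ 40 * ((k : ℝ) + 1) := by positivity
  nlinarith [norm_nonneg p.1]

/-- On `M_k`, `|z| < C_k`. [folklore] -/
theorem norm_fst_lt_drawRadius_of_mem (hp : p ∈ Mset k) : ‖p.1‖ < drawRadius k := by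
  have := norm_fst_le_of_mem hp
  have hk : (0 : ℝ) ≤ k := Nat.cast_nonneg k
  unfold drawRadius; linarith

/-- **Zone dichotomy near the cores**: a point of `M_k` with `|w|² < η ≤ 1/40` lies in an inner
core zone or in the outer core zone. [folklore] -/
theorem mem_zone_of_mem (hη' : η ≤ 1 / 40) (hp : p ∈ Mset k) (hw : ‖p.2‖ ^ 2 < η) :
    (∃ j, p ∈ zoneA k η j) ∨ p ∈ zoneO k η := by
  have hg : 1 - η < planarPot k p.1 := by linarith [hp.2]
  have hw5 : ‖p.2‖ < 1 / 5 := by nlinarith [norm_nonneg p.2]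
  rcases far_or_near_of_le_planarPot (k := k) (Z := p.1) (by linarith) with hfar | ⟨j, hj⟩
  · right
    rw [bigRadius] at hfar
    have hk : (0 : ℝ) ≤ k := Nat.cast_nonneg k
    exact ⟨by linarith, by linarith [norm_fst_le_of_mem hp], hw5, hg⟩
  · left
    exact ⟨j, ⟨by linarith [hp.1 j], hj⟩, hw5, hg⟩

/-- The cutoff vanishes exactly on the lower plateau (`η > 0`). [folklore] -/
theorem cutoff_eq_zero_iff (hη : 0 < η) {g : ℝ} : cutoff η g = 0 ↔ g ≤ 1 - 3 * η / 2 :=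
  ⟨fun h ↦ by
    by_contra h'
    push Not at h'
    have : 0 < cutoff η g := Real.smoothTransition.pos_of_pos (div_pos (by linarith) (by linarith))
    linarith, cutoff_eq_zero hη⟩

/-! ## Bounds on the virtual planar point -/

/-- Near the hole `c_j` the virtual point stays in the punctured disc of radius `27/20` about
`c_j`. [folklore] -/
theorem norm_zmod_sub_holeCentre {j : Fin k} (hz : p.1 ∈ annulus (holeCentre k j) (1 / 2) (27 / 20))
    (hw : p.2 ≠ 0) :
    0 < ‖zmod k η p - holeCentre k j‖ ∧ ‖zmod k η p - holeCentre k j‖ < 27 / 20 := by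
  have hzj := ne_centre_of_mem_annulus (by norm_num) hz
  have hρ := thinRad_lt_half ‖p.2‖
  have hF0 : 0 < profF (holeCentre k j) (planarPot k) (cutoff η) p :=
    profF_pos hzj hw (cutoff_nonneg _ _) (cutoff_le_one _ _)
  have hF1 : profF (holeCentre k j) (planarPot k) (cutoff η) p ≤ ‖p.1 - holeCentre k j‖ :=
    profF_le (cutoff_nonneg _ _) (by linarith [hz.1])
  rw [zmod_of_near hz, norm_thetaB_fst_sub hzj hF0.le]
  exact ⟨hF0, by linarith [hz.2]⟩

/-- In the far zone the virtual point of a point of `M_k` stays far: `|Z_mod| ≥ 18(k+1)`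
(`0 < η ≤ 1/40`). [folklore] -/
theorem le_norm_zmod_of_far (hη : 0 < η) (hη' : η ≤ 1 / 40) (hp : p ∈ Mset k)
    (hz : 18 * ((k : ℝ) + 1) ≤ ‖p.1‖) (hw : p.2 ≠ 0) : 18 * ((k : ℝ) + 1) ≤ ‖zmod k η p‖ := by
  have hk : (0 : ℝ) ≤ k := Nat.cast_nonneg k
  have hzC := norm_fst_lt_drawRadius_of_mem hp
  by_cases hχ : cutoff η (planarPot k p.1) = 0
  · rw [zmod_of_cutoff_eq_zero hχ hzC]; exact hz
  · have hg := lt_of_cutoff_ne_zero hη hχ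
    have h1920 : 19 / 20 ≤ planarPot k p.1 := by linarith
    have h20 : 20 * ((k : ℝ) + 1) ≤ ‖p.1‖ := by
      rcases far_or_near_of_le_planarPot h1920 with hfar | ⟨j, hj⟩
      · rw [bigRadius] at hfar; linarith
      · have h3 := norm_le_norm_sub_add p.1 (holeCentre k j)
        have h4 := norm_holeCentre_le (r := k) j
        linarith
    obtain ⟨hzmod, hF0⟩ := zmod_of_far_eq_outerZ (η := η) hz hzC hw
    rw [hzmod]
    have hco : coLat k p.1 ≠ 0 := coLat_ne_zero_of_lt_norm (by linarith) hzC
    have he : ‖coLatDir k p.1‖ = 1 := norm_coLatDir hco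
    obtain ⟨hs1, hs2⟩ := latS_mem_of_far h20 (planarPot_le_one_of_mem hp) h1920
    set F := cutoff η (planarPot k p.1) * thinRad ‖p.2‖ +
      (1 - cutoff η (planarPot k p.1)) * latS k p.1
    by_cases hFc : F < latC k
    · have h := bigRadius_sq_lt_normSq_outerZ he hF0 hFc
      rw [Complex.normSq_eq_norm_sq, bigRadius] at h
      have h40 : (0 : ℝ) ≤ 40 * ((k : ℝ) + 1) := by positivity
      nlinarith [norm_nonneg (outerZ k (coLatDir k p.1) F)]
    · push Not at hFc
      have hχ0 := cutoff_nonneg η (planarPot k p.1)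
      have hχ1 := cutoff_le_one η (planarPot k p.1)
      have hρ := thinRad_lt_half ‖p.2‖
      have hc1 := lt_latC (k := k)
      have hFs : F ≤ latS k p.1 := by
        show cutoff η (planarPot k p.1) * thinRad ‖p.2‖ +
          (1 - cutoff η (planarPot k p.1)) * latS k p.1 ≤ latS k p.1
        nlinarith
      have := le_norm_outerZ (k := k) he (s := F) ⟨by linarith, by linarith⟩
      linarith

/-- **The virtual point of a point of `M_k` off the cores has positive planar radius**:
`Re Z_mod + C_k > 0` (`0 < η ≤ 1/40`). [folklore] -/
theorem re_zmod_add_drawRadius_pos (hη : 0 < η) (hη' : η ≤ 1 / 40) (hp : p ∈ Mset k)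
    (hw : p.2 ≠ 0) : 0 < (zmod k η p).re + drawRadius k := by
  have hk : (0 : ℝ) ≤ k := Nat.cast_nonneg k
  have hzC := norm_fst_lt_drawRadius_of_mem hp
  have hre : ∀ {ζ : ℂ}, ‖ζ‖ < drawRadius k → 0 < ζ.re + drawRadius k := fun {ζ} h ↦ by
    have := Complex.abs_re_le_norm ζ
    have := neg_abs_le ζ.re
    linarith
  by_cases hχ : cutoff η (planarPot k p.1) = 0
  · rw [zmod_of_cutoff_eq_zero hχ hzC]; exact hre hzC
  · have hg := lt_of_cutoff_ne_zero hη hχ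
    have h1920 : 19 / 20 ≤ planarPot k p.1 := by linarith
    rcases far_or_near_of_le_planarPot h1920 with hfar | ⟨j, hj⟩
    · rw [bigRadius] at hfar
      obtain ⟨hzmod, hF0⟩ := zmod_of_far_eq_outerZ (η := η) (by linarith) hzC hw
      rw [hzmod, outerZ_re, sub_add_cancel]
      have hco : coLat k p.1 ≠ 0 := coLat_ne_zero_of_lt_norm (by linarith) hzC
      have he : ‖coLatDir k p.1‖ = 1 := norm_coLatDir hco
      exact div_pos (mul_pos focal_pos hF0) (one_sub_sqrt_mul_pos hF0 he.le)
    · have hann : p.1 ∈ annulus (holeCentre k j) (1 / 2) (27 / 20) := ⟨by linarith [hp.1 j], hj⟩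
      obtain ⟨-, hlt⟩ := norm_zmod_sub_holeCentre (η := η) hann hw
      refine hre ?_
      have h1 : ‖zmod k η p‖ ≤ ‖zmod k η p - holeCentre k j‖ + ‖holeCentre k j‖ :=
        norm_le_norm_sub_add _ _
      have h2 := norm_holeCentre_le (r := k) j
      unfold drawRadius; linarith

/-! ## The virtual data determine the point -/

/-- `w` is recovered from its norm and direction. [folklore] -/
theorem eq_of_norm_eq_of_unitDir_eq {w w' : ℂ} (hn : ‖w‖ = ‖w'‖) (hu : unitDir 0 w = unitDir 0 w') :
    w = w' := by
  have h1 : ((‖w - 0‖ : ℝ) : ℂ) * unitDir 0 w = w - 0 := norm_mul_unitDir 0 w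
  have h2 : ((‖w' - 0‖ : ℝ) : ℂ) * unitDir 0 w' = w' - 0 := norm_mul_unitDir 0 w'
  simp only [sub_zero] at h1 h2
  rw [← h1, ← h2, hn, hu]

/-- On `M_k` far out with potential `≥ 19/20` the latitude coordinate lies in the outer annulus.
[folklore] -/
theorem latCoord_mem_annulus_of_far (hp : p ∈ Mset k) (hz : 20 * ((k : ℝ) + 1) ≤ ‖p.1‖)
    (hg : 19 / 20 ≤ planarPot k p.1) :
    latCoord k p.1 ∈ annulus 0 (latC k - 1 / 50) (latC k + 1 / 50) := by
  have hk : (0 : ℝ) ≤ k := Nat.cast_nonneg k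
  have hzC := norm_fst_lt_drawRadius_of_mem hp
  have hco : coLat k p.1 ≠ 0 := coLat_ne_zero_of_lt_norm (by linarith) hzC
  obtain ⟨hs1, hs2⟩ := latS_mem_of_far hz (planarPot_le_one_of_mem hp) hg
  have hs : 0 < latS k p.1 := latS_pos_of_norm_lt hzC
  refine ⟨?_, ?_⟩ <;> rw [sub_zero, norm_latCoord hco hs.le] <;> linarith

/-- In the far zone the compression straightening map of the outer collar, in the latitude
coordinate, records the virtual data: `Θᴮ_out (Λ z, w) = (Λ (Z_mod), u_0(w))` on `M_k`. [folklore] -/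
theorem thetaB_out_eq_of_far (hp : p ∈ Mset k) (hz : 18 * ((k : ℝ) + 1) ≤ ‖p.1‖) (hw : p.2 ≠ 0) :
    thetaB 0 (outerPot k) (cutoff η) (latCoord k p.1, p.2) = (latCoord k (zmod k η p), unitDir 0 p.2) := by
  have hk : (0 : ℝ) ≤ k := Nat.cast_nonneg k
  have hzC := norm_fst_lt_drawRadius_of_mem hp
  have hco : coLat k p.1 ≠ 0 := coLat_ne_zero_of_lt_norm (by linarith) hzC
  have hs : 0 < latS k p.1 := latS_pos_of_norm_lt hzC
  have hs1 : latS k p.1 < 1 := latS_lt_one_of_coLat_ne_zero hco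
  have hq0 : latCoord k p.1 ≠ 0 := by
    intro h0; have := norm_latCoord hco hs.le; rw [h0, norm_zero] at this; linarith
  have hpot : outerPot k (latCoord k p.1) = planarPot k p.1 := outerPot_latCoord hco hs
  -- the first component lies in the punctured unit disc
  have hF : 0 < profF 0 (outerPot k) (cutoff η) (latCoord k p.1, p.2) :=
    profF_pos (p := (latCoord k p.1, p.2)) hq0 hw (cutoff_nonneg _ _) (cutoff_le_one _ _)
  have hF1 : profF 0 (outerPot k) (cutoff η) (latCoord k p.1, p.2) < 1 := by
    have hχ0 := cutoff_nonneg η (outerPot k (latCoord k p.1))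
    have hχ1 := cutoff_le_one η (outerPot k (latCoord k p.1))
    have hρ := thinRad_lt_half ‖p.2‖
    rw [profF]; simp only [sub_zero]; rw [norm_latCoord hco hs.le]; nlinarith
  have hnorm1 : ‖(thetaB 0 (outerPot k) (cutoff η) (latCoord k p.1, p.2)).1‖ =
      profF 0 (outerPot k) (cutoff η) (latCoord k p.1, p.2) := by
    rw [← sub_zero (thetaB 0 (outerPot k) (cutoff η) (latCoord k p.1, p.2)).1,
      norm_thetaB_fst_sub (p := (latCoord k p.1, p.2)) hq0 hF.le]
  have hX0 : (thetaB 0 (outerPot k) (cutoff η) (latCoord k p.1, p.2)).1 ≠ 0 := by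
    intro h0; rw [h0, norm_zero] at hnorm1; linarith
  have hX1 : ‖(thetaB 0 (outerPot k) (cutoff η) (latCoord k p.1, p.2)).1‖ < 1 := by rw [hnorm1]; exact hF1
  refine Prod.ext ?_ ?_
  · show _ = latCoord k (zmod k η p)
    rw [zmod_of_far hz, latCoord_latCoordInv hX0 hX1]
  · refine thetaB_snd_of_level (p := (latCoord k p.1, p.2)) ?_
    show outerPot k (latCoord k p.1) + ‖p.2‖ ^ 2 = 1
    rw [hpot]; exact hp.2

/-- Near the hole `c_j` the compression straightening map of the inner collar records the virtual
data: `Θᴮ_j (z, w) = (Z_mod, u_0(w))` on `M_k`. [folklore] -/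
theorem thetaB_in_eq_of_near (hp : p ∈ Mset k) {j : Fin k}
    (hz : p.1 ∈ annulus (holeCentre k j) (1 / 2) (27 / 20)) :
    thetaB (holeCentre k j) (planarPot k) (cutoff η) p = (zmod k η p, unitDir 0 p.2) :=
  Prod.ext (zmod_of_near hz).symm (thetaB_snd_of_level hp.2)

/-- **The virtual data determine the point**: on `M_k ∩ {w ≠ 0}` the map
`(z, w) ↦ (Z_mod(z, w), w/|w|)` is injective (`0 < η ≤ 1/40`). [folklore] -/
theorem eq_of_zmod_eq (hη : 0 < η) (hη' : η ≤ 1 / 40) (hp : p ∈ Mset k) (hq : q ∈ Mset k)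
    (hpw : p.2 ≠ 0) (hqw : q.2 ≠ 0) (h1 : zmod k η p = zmod k η q)
    (h2 : unitDir 0 p.2 = unitDir 0 q.2) : p = q := by
  have hk : (0 : ℝ) ≤ k := Nat.cast_nonneg k
  have hpC := norm_fst_lt_drawRadius_of_mem hp
  have hqC := norm_fst_lt_drawRadius_of_mem hq
  -- the uncompressed case
  have key0 : ∀ {p q : ℂ × ℂ}, p ∈ Mset k → q ∈ Mset k → zmod k η p = zmod k η q →
      unitDir 0 p.2 = unitDir 0 q.2 → cutoff η (planarPot k p.1) = 0 →
      cutoff η (planarPot k q.1) = 0 → p = q := by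
    intro p q hp hq h1 h2 hχp hχq
    rw [zmod_of_cutoff_eq_zero hχp (norm_fst_lt_drawRadius_of_mem hp),
      zmod_of_cutoff_eq_zero hχq (norm_fst_lt_drawRadius_of_mem hq)] at h1
    refine Prod.ext h1 (eq_of_norm_eq_of_unitDir_eq ?_ h2)
    have hn : ‖p.2‖ ^ 2 = ‖q.2‖ ^ 2 := by
      have := hp.2; have := hq.2; rw [h1] at *; linarith
    nlinarith [norm_nonneg p.2, norm_nonneg q.2]
  -- the mixed case is impossible (no return)
  have key1 : ∀ {p q : ℂ × ℂ}, p ∈ Mset k → q ∈ Mset k → p.2 ≠ 0 → zmod k η p = zmod k η q →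
      cutoff η (planarPot k p.1) ≠ 0 → cutoff η (planarPot k q.1) = 0 → False := by
    intro p q hp hq hpw h1 hχp hχq
    have hlt := lt_planarPot_zmod hη hη' hp.1 (planarPot_le_one_of_mem hp) (norm_fst_le_of_mem hp)
      hpw hχp
    rw [h1, zmod_of_cutoff_eq_zero hχq (norm_fst_lt_drawRadius_of_mem hq)] at hlt
    rw [cutoff_eq_zero_iff hη] at hχq
    linarith
  by_cases hχp : cutoff η (planarPot k p.1) = 0 <;> by_cases hχq : cutoff η (planarPot k q.1) = 0
  · exact key0 hp hq h1 h2 hχp hχq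
  · exact (key1 hq hp hqw h1.symm hχq hχp).elim
  · exact (key1 hp hq hpw h1 hχp hχq).elim
  -- both compressed
  have hgp : 19 / 20 ≤ planarPot k p.1 := by linarith [lt_of_cutoff_ne_zero hη hχp]
  have hgq : 19 / 20 ≤ planarPot k q.1 := by linarith [lt_of_cutoff_ne_zero hη hχq]
  -- near/far for each point, with the sharpened far bound `20(k+1) ≤ |z|`
  have hdich : ∀ {p : ℂ × ℂ}, p ∈ Mset k → 19 / 20 ≤ planarPot k p.1 →
      20 * ((k : ℝ) + 1) ≤ ‖p.1‖ ∨ ∃ j, p.1 ∈ annulus (holeCentre k j) (1 / 2) (27 / 20) := by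
    intro p hp hg
    rcases far_or_near_of_le_planarPot hg with hfar | ⟨j, hj⟩
    · left; rw [bigRadius] at hfar; linarith
    · right; exact ⟨j, by linarith [hp.1 j], hj⟩
  -- a near virtual point is close to the origin, a far one is not
  have hnearfar : ∀ {p q : ℂ × ℂ} {j : Fin k}, p ∈ Mset k → q ∈ Mset k → p.2 ≠ 0 → q.2 ≠ 0 →
      zmod k η p = zmod k η q → p.1 ∈ annulus (holeCentre k j) (1 / 2) (27 / 20) →
      20 * ((k : ℝ) + 1) ≤ ‖q.1‖ → False := by
    intro p q j hp hq hpw hqw h1 hjp hfq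
    obtain ⟨-, hlt⟩ := norm_zmod_sub_holeCentre (η := η) hjp hpw
    have hge := le_norm_zmod_of_far hη hη' hq (by linarith) hqw
    rw [← h1] at hge
    have h3 : ‖zmod k η p‖ ≤ ‖zmod k η p - holeCentre k j‖ + ‖holeCentre k j‖ :=
      norm_le_norm_sub_add _ _
    have h4 := norm_holeCentre_le (r := k) j
    linarith
  rcases hdich hp hgp with hfp | ⟨j, hjp⟩ <;> rcases hdich hq hgq with hfq | ⟨i, hiq⟩
  · -- far / far: the outer straightening map in the latitude coordinate is injective
    have hinj := injOn_thetaB (c := (0 : ℂ)) (ĝ := outerPot k) (a₂ := latC k + 1 / 50)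
      half_le_outer_a₁ (monotone_cutoff hη) (cutoff_nonneg η) (cutoff_le_one η) outer_pos outer_radial
    have hep := thetaB_out_eq_of_far (η := η) hp (by linarith) hpw
    have heq := thetaB_out_eq_of_far (η := η) hq (by linarith) hqw
    have hmem_p : (latCoord k p.1, p.2) ∈ {p : ℂ × ℂ | p.1 ∈ annulus 0 (latC k - 1 / 50)
        (latC k + 1 / 50) ∧ p.2 ≠ 0} := ⟨latCoord_mem_annulus_of_far hp hfp hgp, hpw⟩
    have hmem_q : (latCoord k q.1, q.2) ∈ {p : ℂ × ℂ | p.1 ∈ annulus 0 (latC k - 1 / 50)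
        (latC k + 1 / 50) ∧ p.2 ≠ 0} := ⟨latCoord_mem_annulus_of_far hq hfq hgq, hqw⟩
    have hΘ : thetaB 0 (outerPot k) (cutoff η) (latCoord k p.1, p.2) =
        thetaB 0 (outerPot k) (cutoff η) (latCoord k q.1, q.2) := by rw [hep, heq, h1, h2]
    have hΛ := hinj hmem_p hmem_q hΘ
    simp only [Prod.mk.injEq] at hΛ
    refine Prod.ext ?_ hΛ.2
    have hcop : coLat k p.1 ≠ 0 := coLat_ne_zero_of_lt_norm (by linarith) hpC
    have hcoq : coLat k q.1 ≠ 0 := coLat_ne_zero_of_lt_norm (by linarith) hqC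
    rw [← latCoordInv_latCoord hcop (latS_pos_of_norm_lt hpC),
      ← latCoordInv_latCoord hcoq (latS_pos_of_norm_lt hqC), hΛ.1]
  · exact (hnearfar hq hp hqw hpw h1.symm hiq hfp).elim
  · exact (hnearfar hp hq hpw hqw h1 hjp hfq).elim
  · -- near / near: the same hole, and the inner straightening map is injective
    obtain ⟨-, hltp⟩ := norm_zmod_sub_holeCentre (η := η) hjp hpw
    obtain ⟨-, hltq⟩ := norm_zmod_sub_holeCentre (η := η) hiq hqw
    rw [← h1] at hltq
    have hij : j = i := eq_of_norm_sub_holeCentre_lt (by linarith) (by linarith)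
    subst hij
    have hinj := injOn_thetaB (c := holeCentre k j) (ĝ := planarPot k) (a₂ := (27 : ℝ) / 20)
      (le_refl (1 / 2 : ℝ)) (monotone_cutoff hη) (cutoff_nonneg η) (cutoff_le_one η) (inner_pos j)
      (inner_radial j)
    have hΘ : thetaB (holeCentre k j) (planarPot k) (cutoff η) p =
        thetaB (holeCentre k j) (planarPot k) (cutoff η) q := by
      rw [thetaB_in_eq_of_near hp hjp, thetaB_in_eq_of_near hq hiq, h1, h2]
    exact hinj ⟨hjp, hpw⟩ ⟨hiq, hqw⟩ hΘ

/-! ## Core points -/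

/-- A core point (`w = 0`) of `M_k` lies in an inner core zone or in the outer core zone
(`0 < η ≤ 1/40`). [folklore] -/
theorem mem_zone_of_core (hη : 0 < η) (hη' : η ≤ 1 / 40) (hp : p ∈ Mset k) (hw : p.2 = 0) :
    (∃ j, p ∈ zoneA k η j) ∨ p ∈ zoneO k η :=
  mem_zone_of_mem hη' hp (by rw [hw, norm_zero]; simpa using hη)

/-- The outer core point of a core point of the outer core zone is `outerPt (y/|y|) 0`. [folklore] -/
theorem coe_outS_of_core (ho : p ∈ zoneO k η) (hw : p.2 = 0) :
    (outS k p : 𝔼 4) = outerPt k (coLatDir k p.1) 0 := by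
  rw [coe_outS (coLat_ne_zero_of_mem_zoneO ho), outVec, hw, map_zero]
  have : toE2 0 = 0 := toE2_eq_zero_iff.2 rfl
  rw [this, squeeze_zero]

/-- The outer core point of a core point has vanishing planar coordinates `x₀ = x₁ = 0`.
[folklore] -/
theorem outS_core_apply (ho : p ∈ zoneO k η) (hw : p.2 = 0) :
    (outS k p : 𝔼 4) 0 = 0 ∧ (outS k p : 𝔼 4) 1 = 0 := by
  rw [coe_outS_of_core ho hw, outerPt]
  simp

/-- The virtual sphere point of a point of `M_k` off the cores has a nonvanishing planar
coordinate (`0 < η ≤ 1/40`). [folklore] -/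
theorem virtS_apply_ne (hη : 0 < η) (hη' : η ≤ 1 / 40) (hp : p ∈ Mset k) (hw : p.2 ≠ 0) :
    (virtS k η p : 𝔼 4) 0 ≠ 0 ∨ (virtS k η p : 𝔼 4) 1 ≠ 0 := by
  have hpos := re_zmod_add_drawRadius_pos hη hη' hp hw
  have hr := stereoNorthRadSq_add_one_pos (virtC k η p)
  have hu : conj (unitDir 0 p.2) ≠ 0 := by
    rw [map_ne_zero_iff _ (RingHom.injective _), ← norm_ne_zero_iff, norm_unitDir hw]; exact one_ne_zero
  by_contra h
  push Not at h
  obtain ⟨h0, h1⟩ := h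
  rw [coe_virtS, stereoNorthInvCoe_apply_zero, div_eq_zero_iff] at h0
  rw [coe_virtS, stereoNorthInvCoe_apply_one, div_eq_zero_iff] at h1
  have h0' : (virtC k η p).1.1 = 0 := by
    rcases h0 with h0 | h0
    · linarith
    · linarith
  have h1' : (virtC k η p).1.2 = 0 := by
    rcases h1 with h1 | h1
    · linarith
    · linarith
  have hprod : (((zmod k η p).re + drawRadius k : ℝ) : ℂ) * conj (unitDir 0 p.2) = 0 := by
    apply Complex.ext
    · simpa [virtC, cpt] using h0'
    · simpa [virtC, cpt] using h1'
  rcases mul_eq_zero.1 hprod with h | h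
  · have : (zmod k η p).re + drawRadius k = 0 := by exact_mod_cast h
    linarith
  · exact hu h

/-- The virtual data are read off the virtual sphere point: equal virtual sphere points of points
of `M_k` off the cores have equal virtual planar points and equal directions `w/|w|`
(`0 < η ≤ 1/40`). [folklore] -/
theorem zmod_eq_of_virtS_eq (hη : 0 < η) (hη' : η ≤ 1 / 40) (hp : p ∈ Mset k) (hq : q ∈ Mset k)
    (hpw : p.2 ≠ 0) (hqw : q.2 ≠ 0) (h : virtS k η p = virtS k η q) :
    zmod k η p = zmod k η q ∧ unitDir 0 p.2 = unitDir 0 q.2 := by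
  have hc : virtC k η p = virtC k η q :=
    stereoNorthInvCoe_injective (by rw [← coe_virtS, ← coe_virtS, h])
  have hup : ‖conj (unitDir 0 p.2)‖ = 1 := by rw [Complex.norm_conj, norm_unitDir hpw]
  have huq : ‖conj (unitDir 0 q.2)‖ = 1 := by rw [Complex.norm_conj, norm_unitDir hqw]
  have hrp := re_zmod_add_drawRadius_pos hη hη' hp hpw
  have hrq := re_zmod_add_drawRadius_pos hη hη' hq hqw
  have hz : zmod k η p = zmod k η q := by
    rw [← chartZ_cpt (k := k) hup hrp.le, ← chartZ_cpt (k := k) huq hrq.le]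
    exact congrArg (chartZ k) hc
  refine ⟨hz, ?_⟩
  have hC := congrArg chartC hc
  rw [virtC, virtC, chartC_cpt, chartC_cpt, hz] at hC
  have hne : (((zmod k η q).re + drawRadius k : ℝ) : ℂ) ≠ 0 := by
    exact_mod_cast hrq.ne'
  have := mul_left_cancel₀ hne hC
  exact (RingHom.injective _) this

/-- A point of the outer core zone with potential `≥ 19/20` is at distance `≥ 20(k+1)`. [folklore] -/
theorem le_norm_of_mem_zoneO (ho : p ∈ zoneO k η) (hg : 19 / 20 ≤ planarPot k p.1) :
    20 * ((k : ℝ) + 1) ≤ ‖p.1‖ := by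
  have hk : (0 : ℝ) ≤ k := Nat.cast_nonneg k
  rcases far_or_near_of_le_planarPot hg with hfar | ⟨j, hj⟩
  · rw [bigRadius] at hfar; linarith
  · have h3 := norm_le_norm_sub_add p.1 (holeCentre k j)
    have h4 := norm_holeCentre_le (r := k) j
    linarith [ho.1]

/-! ## Injectivity of the model map -/

section Inj

variable {Y : Type*} {JA : (𝕊 3) → Y} {JB : Fin (k + 1) → (𝔼 2) × (𝕊 1) → Y} {fl : Fin k → Bool}
  {LC : Set (𝕊 3)}

/-- `flipS` is injective. [folklore] -/
theorem flipS_injective (b : Bool) : Injective (flipS b) := fun u v h ↦ by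
  have := congrArg (fun w : 𝕊 1 ↦ flipE b (w : 𝔼 2)) h
  simpa using Subtype.ext_iff.2 (by simpa [coe_flipS, flipE_flipE] using this)

/-- The direction of `z − c_j` is read off the solid-torus point. [folklore] -/
theorem unitDir_eq_of_bPt_eq {j : Fin k} (hpz : p.1 ≠ holeCentre k j) (hqz : q.1 ≠ holeCentre k j)
    (h : bPt k fl j p = bPt k fl j q) :
    unitDir (holeCentre k j) p.1 = unitDir (holeCentre k j) q.1 := by
  have h2 := congrArg Prod.snd h
  simp only [bPt] at h2
  have h3 := flipS_injective (fl j) h2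
  have h4 := congrArg (fun u : 𝕊 1 ↦ toC (u : 𝔼 2)) h3
  simpa [coe_holeDirS hpz, coe_holeDirS hqz] using h4

/-- **The model map is injective on the model hypersurface.**  Hypotheses: `JA` injective on the
open set `LC` (the link complement) and the `JB i` injective on the open solid torus, with pairwise
disjoint images; a point glued from the complement has nonzero disc coordinate; the pieces agree on
the inner core zones off the cores; the virtual points (off the cores) and the outer core points of
the relevant points lie in `LC`; `0 < η ≤ 1/40`. [folklore] -/
theorem injOn_modelMap (hη : 0 < η) (hη' : η ≤ 1 / 40) (hJA : InjOn JA LC)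
    (hJB : ∀ i, InjOn (JB i) {b : (𝔼 2) × (𝕊 1) | ‖b.1‖ < 1})
    (hdisj : ∀ i i' (b b' : (𝔼 2) × (𝕊 1)), i ≠ i' → ‖b.1‖ < 1 → ‖b'.1‖ < 1 → JB i b ≠ JB i' b')
    (hglue0 : ∀ i, ∀ a ∈ LC, ∀ b : (𝔼 2) × (𝕊 1), ‖b.1‖ < 1 → JA a = JB i b → b.1 ≠ 0)
    (hagree : ∀ (j : Fin k) (q : ℂ × ℂ), q ∈ zoneA k η j → q.2 ≠ 0 →
      JB (Fin.castSucc j) (bPt k fl j q) = JA (virtS k η q))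
    (hO : ∀ q ∈ zoneO k η, outS k q ∈ LC) :
    InjOn (modelMap k η JA JB fl) {p | p ∈ Mset k ∧ (p.2 ≠ 0 → virtS k η p ∈ LC)} := by
  -- the three kinds of points and their values
  have hval0 : ∀ {p : ℂ × ℂ}, p.2 ≠ 0 → modelMap k η JA JB fl p = JA (virtS k η p) := fun hw ↦
    modelMap_eq_of_ne_zero hη hagree hw
  -- symmetric reduction
  suffices key : ∀ p q : ℂ × ℂ, p ∈ Mset k → (p.2 ≠ 0 → virtS k η p ∈ LC) → q ∈ Mset k →
      (q.2 ≠ 0 → virtS k η q ∈ LC) → modelMap k η JA JB fl p = modelMap k η JA JB fl q →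
      (p.2 = 0 → q.2 = 0) → p = q by
    intro p hp q hq h
    by_cases hpw : p.2 = 0
    · by_cases hqw : q.2 = 0
      · exact key p q hp.1 hp.2 hq.1 hq.2 h fun _ ↦ hqw
      · exact (key q p hq.1 hq.2 hp.1 hp.2 h.symm fun h' ↦ absurd h' hqw).symm
    · exact key p q hp.1 hp.2 hq.1 hq.2 h fun h' ↦ absurd h' hpw
  intro p q hp hpL hq hqL h hcore
  by_cases hpw : p.2 = 0
  · have hqw := hcore hpw
    -- both core points
    rcases mem_zone_of_core hη hη' hp hpw with ⟨j, hj⟩ | hop <;>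
      rcases mem_zone_of_core hη hη' hq hqw with ⟨i, hi⟩ | hoq
    · -- inner / inner
      rw [modelMap_of_mem_zoneA hj, modelMap_of_mem_zoneA hi] at h
      have hb : ‖(bPt k fl j p).1‖ < 1 := by rw [norm_bPt_fst, hpw, norm_zero]; exact one_pos
      have hb' : ‖(bPt k fl i q).1‖ < 1 := by rw [norm_bPt_fst, hqw, norm_zero]; exact one_pos
      have hij : j = i := by
        by_contra hij
        exact hdisj _ _ _ _ (fun h' ↦ hij (Fin.castSucc_injective _ h')) hb hb' h
      subst hij
      have hbb := hJB _ hb hb' h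
      have hpz := ne_holeCentre_of_mem_zoneA hj j
      have hqz := ne_holeCentre_of_mem_zoneA hi j
      have hu := unitDir_eq_of_bPt_eq hpz hqz hbb
      have hinj := injOn_thetaA (c := holeCentre k j) (ĝ := planarPot k) (a₂ := (27 : ℝ) / 20)
        (by norm_num : (0 : ℝ) ≤ 1 / 2) (inner_pos j) (inner_radial j)
      refine hinj (show p.1 ∈ _ from hj.1) (show q.1 ∈ _ from hi.1) ?_
      rw [thetaA_of_level hp.2, thetaA_of_level hq.2, hu, hpw, hqw]
    · -- inner / outer : impossible
      exfalso
      rw [modelMap_of_mem_zoneA hj, modelMap_of_mem_zoneO hoq] at h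
      have hb : ‖(bPt k fl j p).1‖ < 1 := by rw [norm_bPt_fst, hpw, norm_zero]; exact one_pos
      have := hglue0 _ _ (hO q hoq) _ hb h.symm
      rw [← norm_ne_zero_iff, norm_bPt_fst, hpw, norm_zero] at this
      exact this rfl
    · exfalso
      rw [modelMap_of_mem_zoneO hop, modelMap_of_mem_zoneA hi] at h
      have hb : ‖(bPt k fl i q).1‖ < 1 := by rw [norm_bPt_fst, hqw, norm_zero]; exact one_pos
      have := hglue0 _ _ (hO p hop) _ hb h
      rw [← norm_ne_zero_iff, norm_bPt_fst, hqw, norm_zero] at this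
      exact this rfl
    · -- outer / outer
      rw [modelMap_of_mem_zoneO hop, modelMap_of_mem_zoneO hoq] at h
      have hs := hJA (hO p hop) (hO q hoq) h
      have hcop := coLat_ne_zero_of_mem_zoneO hop
      have hcoq := coLat_ne_zero_of_mem_zoneO hoq
      have hvec : outerPt k (coLatDir k p.1) 0 = outerPt k (coLatDir k q.1) 0 := by
        rw [← coe_outS_of_core hop hpw, ← coe_outS_of_core hoq hqw, hs]
      have he := (outerPt_injective (norm_coLatDir hcop) (norm_coLatDir hcoq) (by simp) (by simp)
        hvec).1
      -- same direction: the outer potential is injective along the ray in latitude coordinates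
      have hgp1 : planarPot k p.1 = 1 := by rw [planarPot_eq_of_mem hp, hpw]; simp
      have hgq1 : planarPot k q.1 = 1 := by rw [planarPot_eq_of_mem hq, hqw]; simp
      have hk : (0 : ℝ) ≤ k := Nat.cast_nonneg k
      have hinj := injOn_thetaA (c := (0 : ℂ)) (ĝ := outerPot k) (a₂ := latC k + 1 / 50)
        (le_trans (by norm_num) half_le_outer_a₁) outer_pos outer_radial
      have hmp : latCoord k p.1 ∈ annulus 0 (latC k - 1 / 50) (latC k + 1 / 50) :=
        latCoord_mem_annulus_of_far hp (le_norm_of_mem_zoneO hop (by linarith)) (by linarith)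
      have hmq : latCoord k q.1 ∈ annulus 0 (latC k - 1 / 50) (latC k + 1 / 50) :=
        latCoord_mem_annulus_of_far hq (le_norm_of_mem_zoneO hoq (by linarith)) (by linarith)
      have hsp : 0 < latS k p.1 := latS_pos_of_norm_lt (norm_fst_lt_drawRadius_of_mem hp)
      have hsq : 0 < latS k q.1 := latS_pos_of_norm_lt (norm_fst_lt_drawRadius_of_mem hq)
      have hΘ : thetaA 0 (outerPot k) (latCoord k p.1, 0) = thetaA 0 (outerPot k) (latCoord k q.1, 0) := by
        rw [thetaA_of_level (p := (latCoord k p.1, (0 : ℂ)))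
            (by simp [outerPot_latCoord hcop hsp, hgp1]),
          thetaA_of_level (p := (latCoord k q.1, (0 : ℂ)))
            (by simp [outerPot_latCoord hcoq hsq, hgq1])]
        simp only [unitDir_latCoord hcop hsp, unitDir_latCoord hcoq hsq, he]
      have hΛ := hinj (show (latCoord k p.1, (0 : ℂ)).1 ∈ _ from hmp)
        (show (latCoord k q.1, (0 : ℂ)).1 ∈ _ from hmq) hΘ
      simp only [Prod.mk.injEq, and_true] at hΛ
      refine Prod.ext ?_ (by rw [hpw, hqw])
      rw [← latCoordInv_latCoord hcop hsp, ← latCoordInv_latCoord hcoq hsq, hΛ]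
  · -- `p` off the cores
    have hpv := hval0 hpw
    by_cases hqw : q.2 = 0
    · exfalso
      rcases mem_zone_of_core hη hη' hq hqw with ⟨i, hi⟩ | hoq
      · rw [hpv, modelMap_of_mem_zoneA hi] at h
        have hb : ‖(bPt k fl i q).1‖ < 1 := by rw [norm_bPt_fst, hqw, norm_zero]; exact one_pos
        have := hglue0 _ _ (hpL hpw) _ hb h
        rw [← norm_ne_zero_iff, norm_bPt_fst, hqw, norm_zero] at this
        exact this rfl
      · rw [hpv, modelMap_of_mem_zoneO hoq] at h
        have hs := hJA (hpL hpw) (hO q hoq) h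
        obtain ⟨h0, h1⟩ := outS_core_apply hoq hqw
        rw [← hs] at h0 h1
        rcases virtS_apply_ne hη hη' hp hpw with h' | h'
        · exact h' h0
        · exact h' h1
    · rw [hpv, hval0 hqw] at h
      have hs := hJA (hpL hpw) (hqL hqw) h
      obtain ⟨h1, h2⟩ := zmod_eq_of_virtS_eq hη hη' hp hq hpw hqw hs
      exact eq_of_zmod_eq hη hη' hp hq hpw hqw h1 h2

end Inj

end MMSW

end Literature.Topology.FourManifolds
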